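import Literature.NumberTheory.GaloisRepresentations.RelativeCorestrictionConj
import HarnessLib

/-!
# Transitivity of the RELATIVE corestriction in all degrees: `cor_{V/V'} ∘ cor_{V'/V''} = cor_{V/V''}` (Serre I §2.5)

Topic `NumberTheory/GaloisRepresentations`; namespace `Literature.NumberTheory.GaloisRepresentations`. Definitions with bodies
(two tautological comparison morphisms) and theorems; no named fact, no instance, no `sorry`.

For a profinite group `Γ`, closed subgroups `V'' ≤ V' ≤ V ≤ Γ` of finite successive indices and a discrete `Γ`-module `M` (`ρ`), the tree's
relative corestriction `relCor V V' ρ h q : H^q(V', M) → H^q(V, M)` (`RelativeCorestrictionConj.lean`: the all-degree `cor` of the profinite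
group `↥V` along `V'.subgroupOf V` after the tautological comparison `toSubgroupOf`) is TRANSITIVE in every degree `q`:

  `relCor V V' ρ h q (relCor V' V'' ρ h' q z) = relCor V V'' ρ (h'.trans h) q z`      (`relCor_relCor`).

The tree has the all-degree transitivity of `cor` INSIDE one group (`cor_cor_subgroupOf`, `CorestrictionTransitive.lean`: subgroups
`S' ≤ S ≤ G`) and the transitivity of the degree-`1` transfer corestriction (`coresLe_comp`); the relative statement needs in addition the
TRANSPORT of `cor` along the tautological isomorphism of pairs `(↥V', V''.subgroupOf V') ≅ (↥(V'.subgroupOf V), (V''.subgroupOf V).subgroupOf _)`: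
`toSubgroupOf ∘ cor_{V''.subgroupOf V'} = cor_{(V''.subgroupOf V).subgroupOf (V'.subgroupOf V)} ∘ τ` (`toSubgroupOf_cor`), proved as in
`cor_conjMapSubOf` (there: conjugation; here: `subgroupOfHom`): `cor = H(norm) ∘ sh⁻¹`, the coinduced modules correspond through
`Φ(F) = F ∘ ψ` (`coindAlongHom`), `Φ` intertwines the evaluations at `1` and the norms (`normCoind_coindAlongHom`: the cosets correspond under
`ψ`), and every map in sight is `H^q` of a compatible pair (`map_comp_apply_of`).

Consumer: the degree-`2` specialisation of the junction of crux `SmallImageLowerHalfBothSigns` (stmt-BirchSwinnertonDyer-23599, line `rtt_w3`,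
row S3α brick α1): `relCoresO` (JLK 2011 level groups, `…CarriersO.lean`) is `relCor` on `G_S`, so its transitivity in every degree
(`relCoresO_relCoresO_one` is the degree-`1` case) is a corollary.

References: [SerreGaloisCohomology1997] I §2.5; [NeukirchSchmidtWingberg2008] I §5 Prop. 1.5.3 (iii) (`cor` is transitive).
-/

noncomputable section

open CategoryTheory Function

universe u

namespace Literature.NumberTheory.GaloisRepresentations

open _root_.TopRep _root_.ContRepresentation _root_.ContinuousCohomology

section Transport

variable {Γ : Type u} [Group Γ] [TopologicalSpace Γ] [IsTopologicalGroup Γ] [CompactSpace Γ] [T2Space Γ] [TotallyDisconnectedSpace Γ]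
variable (V V' V'' : Subgroup Γ) [hV : IsClosed (V : Set Γ)] [hV' : IsClosed (V' : Set Γ)] [hV'' : IsClosed (V'' : Set Γ)]
variable {M : Type u} [AddCommGroup M] [TopologicalSpace M] [DiscreteTopology M]
variable (ρ : ContinuousRep Γ ℤ M) (h : V' ≤ V) (h' : V'' ≤ V')

attribute [local instance] compactSpace_of_isClosed_subgroup discreteTopology_coind isClosed_subgroupOf_of_isClosed

/-- Shorthand: `S₁ = V'.subgroupOf V ≤ ↥V`. [cite: SerreGaloisCohomology1997, I §2.5] -/
abbrev subOne : Subgroup V := V'.subgroupOf V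

/-- Shorthand: `S₃ = (V''.subgroupOf V).subgroupOf (V'.subgroupOf V) ≤ ↥(V'.subgroupOf V)` — the copy of `V''` inside the copy of `V'` inside `↥V`.
[cite: SerreGaloisCohomology1997, I §2.5] -/
abbrev subThree : Subgroup (V'.subgroupOf V : Subgroup V) := (V''.subgroupOf V).subgroupOf (V'.subgroupOf V)

/-- Shorthand: the `↥(V'.subgroupOf V)`-module `M`. [cite: SerreGaloisCohomology1997, I §2.5] -/
abbrev repOne : ContinuousRep (V'.subgroupOf V : Subgroup V) ℤ M := (ρ.restrict (subgroupIncl V)).restrict (subgroupIncl (V'.subgroupOf V))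

omit [IsTopologicalGroup Γ] [CompactSpace Γ] [T2Space Γ] [TotallyDisconnectedSpace Γ] [DiscreteTopology M] hV hV' hV'' in
/-- The tautological isomorphism `ψ : ↥(V'.subgroupOf V) → ↥V'` maps `S₃` into `V''.subgroupOf V'`. [cite: SerreGaloisCohomology1997, I §2.5] -/
theorem subgroupOfHom_mem (x : (subThree V V' V'' : Subgroup (V'.subgroupOf V : Subgroup V))) :
    subgroupOfHom h (x : (V'.subgroupOf V : Subgroup V)) ∈ V''.subgroupOf V' := by
  change ((subgroupOfHom h (x : (V'.subgroupOf V : Subgroup V)) : V') : Γ) ∈ V''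
  rw [subgroupOfHom_apply_coe]
  exact x.2

/-- The restriction `ψ' : ↥S₃ → ↥(V''.subgroupOf V')` of the tautological isomorphism `ψ = subgroupOfHom h`. [cite: SerreGaloisCohomology1997, I §2.5] -/
def subThreeHom : (subThree V V' V'' : Subgroup (V'.subgroupOf V : Subgroup V)) →ₜ* (V''.subgroupOf V' : Subgroup V') where
  toFun x := ⟨subgroupOfHom h (x : (V'.subgroupOf V : Subgroup V)), subgroupOfHom_mem V V' V'' h x⟩
  map_one' := rfl
  map_mul' _ _ := rfl
  continuous_toFun := Continuous.subtype_mk ((subgroupOfHom h).continuous.comp continuous_subtype_val) _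

/-- The tautological comparison `τ : H^q(V''.subgroupOf V', M) → H^q(S₃, M)` (pull-back along `ψ'`, identity on `M`). [cite: SerreGaloisCohomology1997, I §2.5] -/
def tauMap (q : ℕ) :
    continuousCohomology q (repSub V' V'' ρ).toTopRep ⟶ continuousCohomology q ((repOne V V' ρ).restrict (subgroupIncl (subThree V V' V''))).toTopRep :=
  ContinuousCohomology.map (subThreeHom V V' V'' h) (TopRep.ofHom ⟨ContinuousLinearMap.id ℤ M, fun _ => rfl⟩) q

/-- **`Φ : M_{V'}^{V''}(M) → M_{S₁}^{S₃}(M)`, `Φ(F) = F ∘ ψ`** — transport of the relative induced module along the tautological isomorphism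
`ψ : ↥S₁ → ↥V'`, a morphism of topological modules over `ψ`. [cite: SerreGaloisCohomology1997, I §2.5] -/
def coindAlongHom :
    TopRep.res (subgroupOfHom h : (V'.subgroupOf V : Subgroup V) →* V') (coindRep (repSub V' V'' ρ)).toTopRep ⟶
      (coindRep ((repOne V V' ρ).restrict (subgroupIncl (subThree V V' V'')))).toTopRep :=
  TopRep.ofHom
    { toLinearMap :=
        { toFun := fun F => ⟨((F : coindModule (repSub V' V'' ρ)) : C(V', M)).comp (subgroupOfHom h).toContinuousMap,
              fun s x => (mem_coind_iff (repSub V' V'' ρ) _).1 (F : coindModule (repSub V' V'' ρ)).2 (subThreeHom V V' V'' h s)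
                (subgroupOfHom h x)⟩
          map_add' := fun F F' => Subtype.ext (ContinuousMap.ext fun x => rfl)
          map_smul' := fun c F => Subtype.ext (ContinuousMap.ext fun x => rfl) }
      cont := continuous_of_discreteTopology
      isIntertwining' := fun g => by ext F x; rfl }

omit [T2Space Γ] [TotallyDisconnectedSpace Γ] hV'' in
/-- `Φ` on elements: `Φ(F)(x) = F(ψ x)`. [cite: SerreGaloisCohomology1997, I §2.5] -/
@[simp] theorem coindAlongHom_coe_apply (F : coindModule (repSub V' V'' ρ)) (x : (V'.subgroupOf V : Subgroup V)) :
    (((coindAlongHom V V' V'' ρ h).hom F : coindModule ((repOne V V' ρ).restrict (subgroupIncl (subThree V V' V'')))) :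
        C((V'.subgroupOf V : Subgroup V), M)) x =
      ((F : coindModule (repSub V' V'' ρ)) : C(V', M)) (subgroupOfHom h x) := rfl

/-- The norm `N_{V'/V''}` read over `ψ : ↥S₁ → ↥V'` (a morphism along `ψ` into `M|_{S₁}`). [cite: SerreGaloisCohomology1997, I §2.5] -/
def normAlongHom [Fintype (V' ⧸ (V''.subgroupOf V'))] :
    TopRep.res (subgroupOfHom h : (V'.subgroupOf V : Subgroup V) →* V') (coindRep (repSub V' V'' ρ)).toTopRep ⟶ (repOne V V' ρ).toTopRep :=
  TopRep.ofHom
    { toLinearMap := (normCoind (S := V''.subgroupOf V') (ρ.restrict (subgroupIncl V'))).hom.toLinearMap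
      cont := continuous_of_discreteTopology
      isIntertwining' := fun s => by
        ext F
        exact TopRep.hom_comm_apply (normCoind (S := V''.subgroupOf V') (ρ.restrict (subgroupIncl V'))) (subgroupOfHom h s) F }

omit [IsTopologicalGroup Γ] [CompactSpace Γ] [T2Space Γ] [TotallyDisconnectedSpace Γ] [DiscreteTopology M] hV hV' hV'' in
/-- The cosets correspond under `ψ`: `c ↦ [ψ c̃]` is a bijection `S₁/S₃ → V'/(V''.subgroupOf V')`. [cite: SerreGaloisCohomology1997, I §2.5] -/
theorem quotMap_bijective :
    Function.Bijective (fun c : (V'.subgroupOf V : Subgroup V) ⧸ (subThree V V' V'' : Subgroup (V'.subgroupOf V : Subgroup V)) ↦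
      (QuotientGroup.mk (subgroupOfHom h c.out) : V' ⧸ (V''.subgroupOf V'))) := by
  constructor
  · intro c c' hcc
    have hmem : (subgroupOfHom h c.out)⁻¹ * subgroupOfHom h c'.out ∈ V''.subgroupOf V' := QuotientGroup.eq.1 hcc
    rw [← QuotientGroup.out_eq' c, ← QuotientGroup.out_eq' c']
    refine QuotientGroup.eq.2 ?_
    change (((c.out⁻¹ * c'.out : (V'.subgroupOf V : Subgroup V)) : V) : Γ) ∈ V''
    have : (((subgroupOfHom h c.out)⁻¹ * subgroupOfHom h c'.out : V') : Γ) ∈ V'' := hmem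
    simpa using this
  · intro d
    set s₁ : (V'.subgroupOf V : Subgroup V) := ⟨⟨(d.out : Γ), h d.out.2⟩, d.out.2⟩ with hs₁
    refine ⟨QuotientGroup.mk s₁, ?_⟩
    have hψ : subgroupOfHom h s₁ = d.out := Subtype.ext rfl
    have hrel : (QuotientGroup.mk s₁ : (V'.subgroupOf V : Subgroup V) ⧸ (subThree V V' V'' : Subgroup (V'.subgroupOf V : Subgroup V))).out⁻¹ * s₁ ∈
        subThree V V' V'' := QuotientGroup.eq.1 (QuotientGroup.out_eq' _)
    change (QuotientGroup.mk (subgroupOfHom h (QuotientGroup.mk s₁ : (V'.subgroupOf V : Subgroup V) ⧸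
        (subThree V V' V'' : Subgroup (V'.subgroupOf V : Subgroup V))).out) : V' ⧸ (V''.subgroupOf V')) = d
    conv_rhs => rw [← QuotientGroup.out_eq' d]
    refine QuotientGroup.eq.2 ?_
    rw [← hψ, ← map_inv, ← map_mul]
    exact subgroupOfHom_mem V V' V'' h ⟨_, hrel⟩

omit [T2Space Γ] [TotallyDisconnectedSpace Γ] hV'' in
/-- **`Φ` intertwines the norms**: `N_{S₁/S₃}(Φ F) = N_{V'/(V''.subgroupOf V')}(F)` (the cosets correspond under `ψ` and each term depends only on the coset).
[cite: SerreGaloisCohomology1997, I §2.5] -/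
theorem normCoind_coindAlongHom [Fintype (V' ⧸ (V''.subgroupOf V'))]
    [Fintype ((V'.subgroupOf V : Subgroup V) ⧸ (subThree V V' V'' : Subgroup (V'.subgroupOf V : Subgroup V)))] (F : coindModule (repSub V' V'' ρ)) :
    (normCoind (S := subThree V V' V'') (repOne V V' ρ)).hom ((coindAlongHom V V' V'' ρ h).hom F) =
      (normCoind (S := V''.subgroupOf V') (ρ.restrict (subgroupIncl V'))).hom F := by
  rw [normCoind_hom_apply, normCoind_hom_apply]
  have hterm : ∀ c : (V'.subgroupOf V : Subgroup V) ⧸ (subThree V V' V'' : Subgroup (V'.subgroupOf V : Subgroup V)),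
      (repOne V V' ρ) c.out ((((coindAlongHom V V' V'' ρ h).hom F : coindModule ((repOne V V' ρ).restrict (subgroupIncl (subThree V V' V'')))) :
          C((V'.subgroupOf V : Subgroup V), M)) c.out⁻¹) =
        normTerm (ρ.restrict (subgroupIncl V')) F (subgroupOfHom h c.out) := fun c ↦ rfl
  simp_rw [hterm]
  refine (Fintype.sum_bijective _ (quotMap_bijective V V' V'' h) _ _ fun c ↦ ?_)
  exact normTerm_eq_of_coe_eq (ρ.restrict (subgroupIncl V')) F (QuotientGroup.out_eq' _).symm

omit [T2Space Γ] [TotallyDisconnectedSpace Γ] hV hV'' in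
/-- The equivariance computation behind `evalAlongHom`: `(χ(s)·F)(ψ 1) = s · F(ψ 1)` for `s ∈ S₃`, `χ = ψ ∘ incl`. [cite: SerreGaloisCohomology1997, I §2.5] -/
theorem coindRep_apply_subgroupOfHom_one (s : (subThree V V' V'' : Subgroup (V'.subgroupOf V : Subgroup V))) (F : coindModule (repSub V' V'' ρ)) :
    (((coindRep (repSub V' V'' ρ)) (subgroupOfHom h (s : (V'.subgroupOf V : Subgroup V))) F : coindModule (repSub V' V'' ρ)) : C(V', M))
        (subgroupOfHom h 1) =
      ρ s.1.1.1 (((F : coindModule (repSub V' V'' ρ)) : C(V', M)) (subgroupOfHom h 1)) := by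
  have hF := (mem_coind_iff (repSub V' V'' ρ) _).1 (F : coindModule (repSub V' V'' ρ)).2 (subThreeHom V V' V'' h s) 1
  rw [mul_one] at hF
  have h1 : subgroupOfHom h (1 : (V'.subgroupOf V : Subgroup V)) = 1 := map_one _
  rw [coindRep_apply_apply, h1, one_mul]
  exact hF

/-- The evaluation `F ↦ Φ(F)(1) = F(ψ 1)` along `χ = ψ ∘ incl_{S₃} : ↥S₃ → ↥V'` (the Shapiro evaluation of `M_{S₁}^{S₃}` after `Φ`).
[cite: SerreGaloisCohomology1997, I §2.5] -/
def evalAlongHom :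
    TopRep.res (((subgroupOfHom h).comp (subgroupIncl (subThree V V' V'')) :
        (subThree V V' V'' : Subgroup (V'.subgroupOf V : Subgroup V)) →ₜ* V') :
        (subThree V V' V'' : Subgroup (V'.subgroupOf V : Subgroup V)) →* V') (coindRep (repSub V' V'' ρ)).toTopRep ⟶
      ((repOne V V' ρ).restrict (subgroupIncl (subThree V V' V''))).toTopRep :=
  TopRep.ofHom
    { toLinearMap := (coindEvalOne ((repOne V V' ρ).restrict (subgroupIncl (subThree V V' V'')))).hom.toLinearMap.comp
        (coindAlongHom V V' V'' ρ h).hom.toLinearMap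
      cont := continuous_of_discreteTopology
      isIntertwining' := fun s => by
        ext F
        exact coindRep_apply_subgroupOfHom_one V V' V'' ρ h s F }

/-- ★ **TRANSPORT OF `cor` ALONG THE TAUTOLOGICAL ISOMORPHISM OF PAIRS**: for `w ∈ H^q(V''.subgroupOf V', M)`,
`toSubgroupOf_{V'≤V} (cor_{V'/(V''.subgroupOf V')} w) = cor_{S₁/S₃} (τ w)` in `H^q(V'.subgroupOf V, M)` (`cor = H(norm) ∘ sh⁻¹`, `Φ` intertwines `sh` and the norms,
`map_comp_apply_of`). [cite: SerreGaloisCohomology1997, I §2.5] [cite: NeukirchSchmidtWingberg2008, I §5 Prop. 1.5.3 (iii)] -/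
theorem toSubgroupOf_cor [Fintype (V' ⧸ (V''.subgroupOf V'))]
    [Fintype ((V'.subgroupOf V : Subgroup V) ⧸ (subThree V V' V'' : Subgroup (V'.subgroupOf V : Subgroup V)))] (q : ℕ)
    (w : continuousCohomology q (repSub V' V'' ρ).toTopRep) :
    toSubgroupOf ρ.toTopRep h q (cor (V''.subgroupOf V') (ρ.restrict (subgroupIncl V')) q w) =
      cor (subThree V V' V'') (repOne V V' ρ) q (tauMap V V' V'' ρ h q w) := by
  set e := extMap (V''.subgroupOf V') (ρ.restrict (subgroupIncl V')) q w with he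
  -- step 1: `toSubgroupOf ∘ H(N) = H^q(ψ, N_ψ)`
  have h1 : toSubgroupOf ρ.toTopRep h q (cohomologyMap (normCoind (S := V''.subgroupOf V') (ρ.restrict (subgroupIncl V'))) q e) =
      ContinuousCohomology.map (subgroupOfHom h) (normAlongHom V V' V'' ρ h) q e :=
    (map_comp_apply_of (ContinuousMonoidHom.id V') (subgroupOfHom h) (subgroupOfHom h) (fun _ => rfl)
      (resIdHom (normCoind (S := V''.subgroupOf V') (ρ.restrict (subgroupIncl V'))))
      (X := (coindRep (repSub V' V'' ρ)).toTopRep) (Y := (ρ.restrict (subgroupIncl V')).toTopRep) (Z := (repOne V V' ρ).toTopRep)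
      (TopRep.ofHom ⟨ContinuousLinearMap.id ℤ M, fun _ => rfl⟩) (normAlongHom V V' V'' ρ h) (fun _ => rfl) q e).symm
  -- step 2: `H^q(ψ, N_ψ) = H(N₁) ∘ H^q(ψ, Φ)`
  have h2 : ContinuousCohomology.map (subgroupOfHom h) (normAlongHom V V' V'' ρ h) q e =
      cohomologyMap (normCoind (S := subThree V V' V'') (repOne V V' ρ)) q (ContinuousCohomology.map (subgroupOfHom h) (coindAlongHom V V' V'' ρ h) q e) :=
    map_comp_apply_of (subgroupOfHom h) (ContinuousMonoidHom.id _) (subgroupOfHom h) (fun _ => rfl)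
      (coindAlongHom V V' V'' ρ h) (resIdHom (normCoind (S := subThree V V' V'') (repOne V V' ρ))) (normAlongHom V V' V'' ρ h)
      (fun F => (normCoind_coindAlongHom V V' V'' ρ h F).symm) q e
  -- step 3: `H^q(ψ, Φ) (ext w) = ext (τ w)` (checked after `sh`, which is injective)
  have h3 : ContinuousCohomology.map (subgroupOfHom h) (coindAlongHom V V' V'' ρ h) q e =
      extMap (subThree V V' V'') (repOne V V' ρ) q (tauMap V V' V'' ρ h q w) := by
    symm
    refine extMap_eq_of_shMap_eq (subThree V V' V'') (repOne V V' ρ) q ?_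
    -- both sides are `H^q` of the pair `(ψ ∘ incl_{S₃}, F ↦ F(1))`
    let χ : (subThree V V' V'' : Subgroup (V'.subgroupOf V : Subgroup V)) →ₜ* V' := (subgroupOfHom h).comp (subgroupIncl (subThree V V' V''))
    let H := evalAlongHom V V' V'' ρ h
    have a : shMap (subThree V V' V'') (repOne V V' ρ) q (ContinuousCohomology.map (subgroupOfHom h) (coindAlongHom V V' V'' ρ h) q e) =
        ContinuousCohomology.map χ H q e :=
      (map_comp_apply_of (subgroupOfHom h) (subgroupIncl (subThree V V' V'')) χ (fun _ => rfl) (coindAlongHom V V' V'' ρ h)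
        (coindEvalOne ((repOne V V' ρ).restrict (subgroupIncl (subThree V V' V'')))) H (fun _ => rfl) q e).symm
    have b : tauMap V V' V'' ρ h q w = ContinuousCohomology.map χ H q e := by
      rw [← sh_extMap (V''.subgroupOf V') (ρ.restrict (subgroupIncl V')) q w, ← he]
      exact (map_comp_apply_of (subgroupIncl (V''.subgroupOf V')) (subThreeHom V V' V'' h) χ (fun _ => rfl)
        (coindEvalOne (repSub V' V'' ρ)) (TopRep.ofHom ⟨ContinuousLinearMap.id ℤ M, fun _ => rfl⟩) H (fun _ => rfl) q e).symm
    rw [a, b]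
  rw [cor_apply, ← he, h1, h2, h3, ← cor_apply]

end Transport

/-! ### Transitivity of `relCor` -/

section RelCorTrans

variable {Γ : Type u} [Group Γ] [TopologicalSpace Γ] [IsTopologicalGroup Γ] [CompactSpace Γ] [T2Space Γ] [TotallyDisconnectedSpace Γ]
variable (V V' V'' : Subgroup Γ) [hV : IsClosed (V : Set Γ)] [hV' : IsClosed (V' : Set Γ)] [hV'' : IsClosed (V'' : Set Γ)]
variable {M : Type u} [AddCommGroup M] [TopologicalSpace M] [DiscreteTopology M]
variable (ρ : ContinuousRep Γ ℤ M) (h : V' ≤ V) (h' : V'' ≤ V')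

attribute [local instance] compactSpace_of_isClosed_subgroup discreteTopology_coind isClosed_subgroupOf_of_isClosed

/-- ★★ **TRANSITIVITY OF THE RELATIVE CORESTRICTION, ALL DEGREES**: `relCor V V' (relCor V' V'' z) = relCor V V'' z` for closed subgroups
`V'' ≤ V' ≤ V` of a profinite group with finite indices and a discrete module `M` (Serre I §2.5; NSW I Prop. 1.5.3 (iii)). From `toSubgroupOf_cor`
(transport to the group `↥V`), `cor_cor_subgroupOf` (transitivity inside `↥V`) and the composition of the three tautological comparisons.
[cite: SerreGaloisCohomology1997, I §2.5] [cite: NeukirchSchmidtWingberg2008, I §5 Prop. 1.5.3 (iii)] -/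
theorem relCor_relCor [Fintype (V ⧸ (V'.subgroupOf V))] [Fintype (V' ⧸ (V''.subgroupOf V'))] [Fintype (V ⧸ (V''.subgroupOf V))]
    [Fintype ((V'.subgroupOf V : Subgroup V) ⧸ (subThree V V' V'' : Subgroup (V'.subgroupOf V : Subgroup V)))] (q : ℕ)
    (z : continuousCohomology q (ρ.restrict (subgroupIncl V'')).toTopRep) :
    relCor V V' ρ h q (relCor V' V'' ρ h' q z) = relCor V V'' ρ (h'.trans h) q z := by
  have h13 : V''.subgroupOf V ≤ V'.subgroupOf V := fun x hx ↦ h' hx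
  rw [relCor_apply, relCor_apply, relCor_apply, toSubgroupOf_cor V V' V'' ρ h q, cor_cor_subgroupOf (V'.subgroupOf V) (V''.subgroupOf V)
    (ρ.restrict (subgroupIncl V)) h13 q]
  congr 1
  -- the three tautological comparisons compose to the one along `V'' ≤ V`
  have e1 : tauMap V V' V'' ρ h q (toSubgroupOf ρ.toTopRep h' q z) =
      ContinuousCohomology.map ((subgroupOfHom h').comp (subThreeHom V V' V'' h)) (X := (ρ.restrict (subgroupIncl V'')).toTopRep)
        (Y := ((repOne V V' ρ).restrict (subgroupIncl (subThree V V' V''))).toTopRep)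
        (TopRep.ofHom ⟨ContinuousLinearMap.id ℤ M, fun _ => rfl⟩) q z :=
    (map_comp_apply_of (subgroupOfHom h') (subThreeHom V V' V'' h) ((subgroupOfHom h').comp (subThreeHom V V' V'' h)) (fun _ => rfl)
      (X := (ρ.restrict (subgroupIncl V'')).toTopRep) (Y := (repSub V' V'' ρ).toTopRep) (Z := ((repOne V V' ρ).restrict (subgroupIncl (subThree V V' V''))).toTopRep)
      (TopRep.ofHom ⟨ContinuousLinearMap.id ℤ M, fun _ => rfl⟩) (TopRep.ofHom ⟨ContinuousLinearMap.id ℤ M, fun _ => rfl⟩)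
      (TopRep.ofHom ⟨ContinuousLinearMap.id ℤ M, fun _ => rfl⟩) (fun _ => rfl) q z).symm
  rw [e1]
  exact (map_comp_apply_of ((subgroupOfHom h').comp (subThreeHom V V' V'' h)) (toSubgroupOfHom (V'.subgroupOf V) (V''.subgroupOf V) h13)
    (subgroupOfHom (h'.trans h)) (fun _ => rfl) (X := (ρ.restrict (subgroupIncl V'')).toTopRep)
    (Y := ((repOne V V' ρ).restrict (subgroupIncl (subThree V V' V''))).toTopRep) (Z := ((ρ.restrict (subgroupIncl V)).restrict (subgroupIncl (V''.subgroupOf V))).toTopRep)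
    (TopRep.ofHom ⟨ContinuousLinearMap.id ℤ M, fun _ => rfl⟩) (TopRep.ofHom ⟨ContinuousLinearMap.id ℤ M, fun _ => rfl⟩)
    (TopRep.ofHom ⟨ContinuousLinearMap.id ℤ M, fun _ => rfl⟩) (fun _ => rfl) q z).symm

end RelCorTrans

end Literature.NumberTheory.GaloisRepresentations

end
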